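import Summits.Ventures.HSemireg.WedgeHankelRecurrenceCompleteIntersection

/-!
# Venture HSemireg — THE GENERIC CLASS: for a class `q` on `[0, 2t]` of TOP middle rank `R^{2t}(q) = t + 1` (no recurrence inside the window) **the recurrences form a complete intersection of
# type `(t + 1, t + 1)`: `Rec_k(q) = 0` for `k ≤ t`, `dim Rec_{t+1}(q) = 2`, and for ANY two independent `g₁, g₂ ∈ Rec_{t+1}(q)`, `Rec_{t+1+j}(q) = g₁·K[X]_{≤ j} ⊕ g₂·K[X]_{≤ j}` (direct) for
# every `j ≤ t`, `K[X]_{≤ 2t+1} = g₁·K[X]_{≤ t} ⊕ g₂·K[X]_{≤ t}`, `gcd(g₁, g₂) = 1`; the elements of `Rec_{t+1}(q)` of degree `≤ t` form a LINE** (so a basis `g₁` of degree `≤ t`, `g₂` of degree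
# `t + 1` exists) — with N56 (`2r ≤ N + 1`) every class on every `[0, N]` now has its recurrence module presented as a complete intersection

HONEST FRAMING. Part of the Lean index of the computation cell `pub-hsemireg` (seat p10 gen 29, Sunday typer «UNIFORM-IN-n»).
LINEAR ALGEBRA OF HANKEL (catalecticant) MATRICES and of polynomials over a field ONLY: no variety, no cohomology theory, no sheaf, no Ext group and no semiregularity map is constructed
here; nothing here says that HC / HC_CM / HC_AV holds; no Literature fact is declared or used.  Custodian versions as in `WedgeHankelSiegelIdeal` (1/3); the dictionary («a general binary form
of even degree `2t` has apolar ideal a complete intersection of two forms of degree `t + 1`», Iarrobino–Kanev) is QUOTED, never asserted.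

WHAT IS IN THE TREE / CHAINED.  N56 (`WedgeHankelRecurrenceCompleteIntersection`, № 380): `mem_recSpace_of_X_mul_mem`, `recSpace_succ_inf_map_mulLeft_X`, `map_mulLeft_X_map_mulRight_degreeLT_le`,
`map_mulRight_degreeLT_mono` (the case `2r ≤ N + 1` is there); N18 (№ 173): `finrank_recSpace_eq_sub_min`, `recSpace_eq_degreeLT_of_lt`, `recSpace_eq_bot_of_lt`, `finiteDimensional_recSpace`,
`finrank_polynomial_degreeLT`, `map_mulRight_degreeLT_le_recSpace`, `finrank_map_mulRight_degreeLT`, `recSpace_le_succ`, `X_mul_mem_recSpace_succ`, `recSpace_le_degreeLT`, `mem_degreeLT_succ_iff`;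
N29 (№ 237) `mem_recSpace_succ_succ_iff`; N42 (№ 275) `rank_half_level_succ_le_add_one`.  Mathlib: `Submodule.finrank_sup_add_finrank_inf_eq`, `Submodule.eq_of_le_of_finrank_eq`, `Submodule.finrank_mono`,
`Submodule.finrank_eq_zero`, `Submodule.equivMapOfInjective`, `Submodule.exists_mem_ne_zero_of_ne_bot` / `Submodule.finrank_span_singleton`-style facts via `finrank_map_mulRight_degreeLT`.
THIS FILE (namespace `Summit.Ventures.HSemireg.Wedge.HankelOuter` continued; CHAINED on N56; 0 definitions).  Level `N = t + t`, `R := R^{t+t}(q) = t + 1`; pieces `A_j := (degreeLT K (j+1)).map (mulRight g₁)`,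
`B_j := (degreeLT K (j+1)).map (mulRight g₂)` spelled out.
* §590 DIMENSIONS: `recSpace_top_eq_bot` (`k ≤ t ⇒ Rec_k = 0`), **`finrank_recSpace_top`** (`t ≤ k ≤ 2t + 1 ⇒ dim Rec_k = 2k − 2t`), **`recSpace_succ_eq_sup_map_mulLeft_X_top`** (`t + 1 ≤ k ≤ 2t ⇒
  Rec_{k+1} = Rec_k + X·Rec_k`).
* §591 THE COMPLETE INTERSECTION OF TYPE `(t+1, t+1)`: **`exists_pair_mem_recSpace_top`** (independent `g₁, g₂ ∈ Rec_{t+1}` exist), **`recSpace_top_eq_sup_of_not_mem`** (`0 ≠ g₁ ∈ Rec_{t+1}`,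
  `g₂ ∈ Rec_{t+1} ∖ K·g₁ ⇒ Rec_{t+1+j} = A_j ⊔ B_j`, `j ≤ t`), **`map_mulRight_inf_map_mulRight_eq_bot_top`** (direct), **`degreeLT_eq_sup_top`** (`K[X]_{≤ 2t+1} = g₁·K[X]_{≤ t} ⊕ g₂·K[X]_{≤ t}`),
  **`isCoprime_of_not_mem_top`** (`gcd(g₁, g₂) = 1`).
* §592 DEGREES: **`finrank_recSpace_inf_degreeLT_top`** (the elements of `Rec_{t+1}` of degree `≤ t` form a line), **`exists_basis_recSpace_top`** (a basis `g₁` of degree `≤ t`, `g₂` of degree `t + 1`).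
Nothing Ext-side.  New names only.
-/

open Module Polynomial
open scoped Matrix Polynomial

namespace Summit.Ventures.HSemireg.Wedge.HankelOuter

open Summit.Ventures.HSemireg.Wedge Summit.Ventures.HSemireg.Wedge.Hankel

variable (K : Type*) [Field K]

/-- transport of the middle rank along an equality of levels (utility, private; `hankel1`'s type depends on the level). -/
private theorem rank_half_eq_of_level_eq {N M : ℕ} (h : N = M) (q : ℕ → K) : (hankel1 K N (N / 2) q).rank = (hankel1 K M (M / 2) q).rank := by
  subst h; rfl

/-! ## §590. The top rank: dimensions and generation by the first step -/

/-- no recurrence inside the window: `R^{2t}(q) = t + 1`, `k ≤ t ⇒ Rec_k(q) = 0` (N18). -/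
theorem recSpace_top_eq_bot {t k : ℕ} {q : ℕ → K} (hq : (hankel1 K (t + t) ((t + t) / 2) q).rank = t + 1) (hk : k ≤ t) : recSpace K (t + t) q k = ⊥ :=
  recSpace_eq_bot_of_lt K hq (by omega)

/-- **`dim Rec_k(q) = 2k − 2t` for `t ≤ k ≤ 2t + 1`** when `R^{2t}(q) = t + 1` (N18's row with the minimum at `2t + 1 − k`; `k = 2t + 1` is everything). -/
theorem finrank_recSpace_top {t k : ℕ} {q : ℕ → K} (hq : (hankel1 K (t + t) ((t + t) / 2) q).rank = t + 1) (hk1 : t ≤ k) (hk2 : k ≤ t + t + 1) :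
    finrank K (recSpace K (t + t) q k) = 2 * k - 2 * t := by
  rcases Nat.lt_or_ge (t + t) k with hlt | hle
  · rw [recSpace_eq_degreeLT_of_lt K hlt, finrank_polynomial_degreeLT]; omega
  · rw [finrank_recSpace_eq_sub_min K hle q, hq, min_eq_right (show t + t + 1 - k ≤ k + 1 by omega), min_eq_left (show t + t + 1 - k ≤ t + 1 by omega)]
    omega

/-- **`Rec_{k+1}(q) = Rec_k(q) + X·Rec_k(q)` for `t + 1 ≤ k ≤ 2t`** when `R^{2t}(q) = t + 1` (dimensions `2, 4, …, 2t + 2` in arithmetic progression; the intersection is `X·Rec_{k−1}`, N56 §580). -/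
theorem recSpace_succ_eq_sup_map_mulLeft_X_top {t k : ℕ} {q : ℕ → K} (hq : (hankel1 K (t + t) ((t + t) / 2) q).rank = t + 1) (hk1 : t + 1 ≤ k) (hk2 : k ≤ t + t) :
    recSpace K (t + t) q (k + 1) = recSpace K (t + t) q k ⊔ (recSpace K (t + t) q k).map (LinearMap.mulLeft K (Polynomial.X : K[X])) := by
  obtain ⟨k, rfl⟩ : ∃ k', k = k' + 1 := ⟨k - 1, by omega⟩
  haveI := finiteDimensional_recSpace K (N := t + t) q k
  haveI := finiteDimensional_recSpace K (N := t + t) q (k + 1)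
  haveI := finiteDimensional_recSpace K (N := t + t) q (k + 1 + 1)
  symm
  refine Submodule.eq_of_le_of_finrank_eq (sup_le (recSpace_le_succ K q (k + 1)) ?_) ?_
  · rintro _ ⟨p, hp, rfl⟩
    exact X_mul_mem_recSpace_succ K hp
  · have hsum := Submodule.finrank_sup_add_finrank_inf_eq (recSpace K (t + t) q (k + 1)) ((recSpace K (t + t) q (k + 1)).map (LinearMap.mulLeft K (Polynomial.X : K[X])))
    have hinjX : Function.Injective (LinearMap.mulLeft K (Polynomial.X : K[X])) := mul_right_injective₀ Polynomial.X_ne_zero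
    rw [recSpace_succ_inf_map_mulLeft_X K (show k + 1 ≤ t + t by omega), ← (Submodule.equivMapOfInjective _ hinjX (recSpace K (t + t) q (k + 1))).finrank_eq,
      ← (Submodule.equivMapOfInjective _ hinjX (recSpace K (t + t) q k)).finrank_eq, finrank_recSpace_top K hq (k := k + 1) (by omega) (by omega),
      finrank_recSpace_top K hq (k := k) (by omega) (by omega)] at hsum
    rw [finrank_recSpace_top K hq (k := k + 1 + 1) (by omega) (by omega)]
    omega

/-! ## §591. The complete intersection of type `(t + 1, t + 1)` -/

section TopCI

variable {K}
variable {t : ℕ} {q : ℕ → K} {g₁ g₂ : K[X]}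

variable (K)

/-- **TWO INDEPENDENT RECURRENCES OF WINDOW `t + 2` EXIST** (`dim Rec_{t+1} = 2`): `0 ≠ g₁ ∈ Rec_{t+1}(q)` and `g₂ ∈ Rec_{t+1}(q) ∖ K·g₁`. -/
theorem exists_pair_mem_recSpace_top (hq : (hankel1 K (t + t) ((t + t) / 2) q).rank = t + 1) :
    ∃ g₁ g₂ : K[X], g₁ ∈ recSpace K (t + t) q (t + 1) ∧ g₁ ≠ 0 ∧ g₂ ∈ recSpace K (t + t) q (t + 1) ∧ g₂ ∉ (Polynomial.degreeLT K (0 + 1)).map (LinearMap.mulRight K g₁) := by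
  haveI := finiteDimensional_recSpace K (N := t + t) q (t + 1)
  have hdim := finrank_recSpace_top K hq (k := t + 1) (by omega) (by omega)
  have hne : recSpace K (t + t) q (t + 1) ≠ ⊥ := by
    intro h; rw [h, finrank_bot] at hdim; omega
  obtain ⟨g₁, hg₁, hg₁0⟩ := Submodule.exists_mem_ne_zero_of_ne_bot hne
  have hlt : ¬ recSpace K (t + t) q (t + 1) ≤ (Polynomial.degreeLT K (0 + 1)).map (LinearMap.mulRight K g₁) := by
    intro hle
    have h1 := Submodule.finrank_mono hle
    rw [finrank_map_mulRight_degreeLT K hg₁0, hdim] at h1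
    omega
  obtain ⟨g₂, hg₂, hg₂A⟩ := Set.not_subset.mp hlt
  exact ⟨g₁, g₂, hg₁, hg₁0, hg₂, hg₂A⟩

/-- **THE COMPLETE INTERSECTION: `Rec_{t+1+j}(q) = g₁·K[X]_{≤ j} + g₂·K[X]_{≤ j}` for every `j ≤ t`**, for `R^{2t}(q) = t + 1`, `0 ≠ g₁ ∈ Rec_{t+1}(q)` and ANY `g₂ ∈ Rec_{t+1}(q) ∖ K·g₁`
(`j = 0`: the two lines meet in `0`, total dimension `2`; `j → j + 1`: `Rec_{k+1} = Rec_k + X·Rec_k` and both pieces absorb the shift). -/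
theorem recSpace_top_eq_sup_of_not_mem (hq : (hankel1 K (t + t) ((t + t) / 2) q).rank = t + 1) (hg₁ : g₁ ∈ recSpace K (t + t) q (t + 1)) (hg₁0 : g₁ ≠ 0)
    (hg₂ : g₂ ∈ recSpace K (t + t) q (t + 1)) (hg₂A : g₂ ∉ (Polynomial.degreeLT K (0 + 1)).map (LinearMap.mulRight K g₁)) :
    ∀ {j : ℕ}, j ≤ t → recSpace K (t + t) q (t + 1 + j) = (Polynomial.degreeLT K (j + 1)).map (LinearMap.mulRight K g₁) ⊔ (Polynomial.degreeLT K (j + 1)).map (LinearMap.mulRight K g₂) := by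
  have hg₂0 : g₂ ≠ 0 := by rintro rfl; exact hg₂A (Submodule.zero_mem _)
  have hA : ∀ j, (Polynomial.degreeLT K (j + 1)).map (LinearMap.mulRight K g₁) ≤ recSpace K (t + t) q (t + 1 + j) := fun j => map_mulRight_degreeLT_le_recSpace K hg₁ j
  have hB : ∀ j, (Polynomial.degreeLT K (j + 1)).map (LinearMap.mulRight K g₂) ≤ recSpace K (t + t) q (t + 1 + j) := fun j => map_mulRight_degreeLT_le_recSpace K hg₂ j
  intro j
  induction j with
  | zero =>
    intro _
    haveI := finiteDimensional_recSpace K (N := t + t) q (t + 1)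
    rw [Nat.add_zero]
    refine (Submodule.eq_of_le_of_finrank_eq (sup_le (by have := hA 0; rwa [Nat.add_zero] at this) (by have := hB 0; rwa [Nat.add_zero] at this)) ?_).symm
    have hinf : (Polynomial.degreeLT K (0 + 1)).map (LinearMap.mulRight K g₁) ⊓ (Polynomial.degreeLT K (0 + 1)).map (LinearMap.mulRight K g₂) = ⊥ := by
      rw [Submodule.eq_bot_iff]
      rintro x ⟨hxA, ⟨ρ, hρ, rfl⟩⟩
      set c : K := ρ.coeff 0
      have hρC : ρ = Polynomial.C c := Polynomial.eq_C_of_natDegree_le_zero ((mem_degreeLT_succ_iff K).mp hρ)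
      have hxA' : ρ * g₂ ∈ (Polynomial.degreeLT K (0 + 1)).map (LinearMap.mulRight K g₁) := hxA
      rcases eq_or_ne c 0 with hc | hc
      · rw [LinearMap.mulRight_apply, hρC, hc, Polynomial.C_0, zero_mul]
      · exfalso
        refine hg₂A ?_
        rw [hρC] at hxA'
        have hx := Submodule.smul_mem _ c⁻¹ hxA'
        rw [← Polynomial.C_mul', ← mul_assoc, ← Polynomial.C_mul, inv_mul_cancel₀ hc, Polynomial.C_1, one_mul] at hx
        exact hx
    have hsum := Submodule.finrank_sup_add_finrank_inf_eq ((Polynomial.degreeLT K (0 + 1)).map (LinearMap.mulRight K g₁)) ((Polynomial.degreeLT K (0 + 1)).map (LinearMap.mulRight K g₂))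
    rw [hinf, finrank_bot, Nat.add_zero, finrank_map_mulRight_degreeLT K hg₁0, finrank_map_mulRight_degreeLT K hg₂0] at hsum
    rw [hsum, finrank_recSpace_top K hq (by omega) (by omega)]
    omega
  | succ j ih =>
    intro hj
    have hstep := recSpace_succ_eq_sup_map_mulLeft_X_top K hq (k := t + 1 + j) (by omega) (by omega)
    rw [show t + 1 + (j + 1) = t + 1 + j + 1 by omega, hstep, ih (by omega), Submodule.map_sup]
    refine le_antisymm (sup_le (sup_le_sup (map_mulRight_degreeLT_mono g₁ (by omega)) (map_mulRight_degreeLT_mono g₂ (by omega)))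
      (sup_le_sup (map_mulLeft_X_map_mulRight_degreeLT_le (K := K) g₁ j) (map_mulLeft_X_map_mulRight_degreeLT_le (K := K) g₂ j))) ?_
    rw [← Submodule.map_sup, ← ih (by omega), ← hstep, ← show t + 1 + (j + 1) = t + 1 + j + 1 by omega]
    exact sup_le (hA (j + 1)) (hB (j + 1))

/-- **THE SUM IS DIRECT: `g₁·K[X]_{≤ j} ⊓ g₂·K[X]_{≤ j} = 0` for `j ≤ t`** (dimensions `(j + 1) + (j + 1) = 2(t + 1 + j) − 2t`). -/
theorem map_mulRight_inf_map_mulRight_eq_bot_top (hq : (hankel1 K (t + t) ((t + t) / 2) q).rank = t + 1) (hg₁ : g₁ ∈ recSpace K (t + t) q (t + 1)) (hg₁0 : g₁ ≠ 0)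
    (hg₂ : g₂ ∈ recSpace K (t + t) q (t + 1)) (hg₂A : g₂ ∉ (Polynomial.degreeLT K (0 + 1)).map (LinearMap.mulRight K g₁)) {j : ℕ} (hj : j ≤ t) :
    (Polynomial.degreeLT K (j + 1)).map (LinearMap.mulRight K g₁) ⊓ (Polynomial.degreeLT K (j + 1)).map (LinearMap.mulRight K g₂) = ⊥ := by
  have hg₂0 : g₂ ≠ 0 := by rintro rfl; exact hg₂A (Submodule.zero_mem _)
  have hsum := Submodule.finrank_sup_add_finrank_inf_eq ((Polynomial.degreeLT K (j + 1)).map (LinearMap.mulRight K g₁)) ((Polynomial.degreeLT K (j + 1)).map (LinearMap.mulRight K g₂))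
  rw [← recSpace_top_eq_sup_of_not_mem K hq hg₁ hg₁0 hg₂ hg₂A hj, finrank_map_mulRight_degreeLT K hg₁0, finrank_map_mulRight_degreeLT K hg₂0, finrank_recSpace_top K hq (by omega) (by omega)] at hsum
  rw [← Submodule.finrank_eq_zero]
  omega

/-- **THE TOP DEGREE: `K[X]_{≤ 2t+1} = g₁·K[X]_{≤ t} + g₂·K[X]_{≤ t}`** (`j = t`: `Rec_{2t+1}(q)` is everything). -/
theorem degreeLT_eq_sup_top (hq : (hankel1 K (t + t) ((t + t) / 2) q).rank = t + 1) (hg₁ : g₁ ∈ recSpace K (t + t) q (t + 1)) (hg₁0 : g₁ ≠ 0)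
    (hg₂ : g₂ ∈ recSpace K (t + t) q (t + 1)) (hg₂A : g₂ ∉ (Polynomial.degreeLT K (0 + 1)).map (LinearMap.mulRight K g₁)) :
    Polynomial.degreeLT K (t + t + 1 + 1) = (Polynomial.degreeLT K (t + 1)).map (LinearMap.mulRight K g₁) ⊔ (Polynomial.degreeLT K (t + 1)).map (LinearMap.mulRight K g₂) := by
  have h := recSpace_top_eq_sup_of_not_mem K hq hg₁ hg₁0 hg₂ hg₂A (j := t) le_rfl
  rw [show t + 1 + t = t + t + 1 by omega, recSpace_eq_degreeLT_of_lt K (Nat.lt_succ_self (t + t))] at h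
  exact h

/-- **THE TWO GENERATORS ARE COPRIME: `IsCoprime g₁ g₂`** (`1 ∈ K[X]_{≤ 2t+1} = g₁·K[X]_{≤ t} + g₂·K[X]_{≤ t}`). -/
theorem isCoprime_of_not_mem_top (hq : (hankel1 K (t + t) ((t + t) / 2) q).rank = t + 1) (hg₁ : g₁ ∈ recSpace K (t + t) q (t + 1)) (hg₁0 : g₁ ≠ 0)
    (hg₂ : g₂ ∈ recSpace K (t + t) q (t + 1)) (hg₂A : g₂ ∉ (Polynomial.degreeLT K (0 + 1)).map (LinearMap.mulRight K g₁)) : IsCoprime g₁ g₂ := by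
  have h1 : (1 : K[X]) ∈ Polynomial.degreeLT K (t + t + 1 + 1) := (mem_degreeLT_succ_iff K).mpr (by rw [Polynomial.natDegree_one]; exact Nat.zero_le _)
  rw [degreeLT_eq_sup_top K hq hg₁ hg₁0 hg₂ hg₂A, Submodule.mem_sup] at h1
  obtain ⟨_, ⟨u, -, rfl⟩, _, ⟨v, -, rfl⟩, huv⟩ := h1
  exact ⟨u, v, by simpa only [LinearMap.mulRight_apply] using huv⟩

end TopCI

/-! ## §592. Degrees: exactly one line of recurrences of window `t + 2` has degree `≤ t` -/

/-- **THE ELEMENTS OF `Rec_{t+1}(q)` OF DEGREE `≤ t` FORM A LINE: `dim (Rec_{t+1}(q) ⊓ K[X]_{≤ t}) = 1`** for `R^{2t}(q) = t + 1` (`t = 0` directly; `t ≥ 1`: the intersection is the level-`(2t−1)`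
space `Rec^{2t−1}_t(q)` (N29), of dimension `t + 1 − min(t, R^{2t−1}(q)) = 1` since `R^{2t−1}(q) ≥ t` (N42)). -/
theorem finrank_recSpace_inf_degreeLT_top {t : ℕ} {q : ℕ → K} (hq : (hankel1 K (t + t) ((t + t) / 2) q).rank = t + 1) :
    finrank K ↥(recSpace K (t + t) q (t + 1) ⊓ Polynomial.degreeLT K (t + 1)) = 1 := by
  rcases Nat.eq_zero_or_pos t with rfl | ht
  · rw [recSpace_eq_degreeLT_of_lt K (show 0 + 0 < 0 + 1 by omega), inf_eq_right.mpr (Polynomial.degreeLT_mono (by omega)), finrank_polynomial_degreeLT]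
  · obtain ⟨t', rfl⟩ : ∃ t', t = t' + 1 := ⟨t - 1, by omega⟩
    -- level `N = t + t = (t' + t' + 1) + 1`
    have hW : recSpace K (t' + 1 + (t' + 1)) q (t' + 1 + 1) ⊓ Polynomial.degreeLT K (t' + 1 + 1) = recSpace K (t' + t' + 1) q (t' + 1) := by
      ext p
      rw [Submodule.mem_inf, show t' + 1 + (t' + 1) = t' + t' + 1 + 1 by omega]
      constructor
      · rintro ⟨hp, hdeg⟩
        exact (mem_recSpace_succ_succ_iff K hdeg).mp hp
      · intro hp
        have hdeg : p ∈ Polynomial.degreeLT K (t' + 1 + 1) := recSpace_le_degreeLT K q _ hp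
        exact ⟨(mem_recSpace_succ_succ_iff K hdeg).mpr hp, hdeg⟩
    rw [hW]
    have hR := rank_half_level_succ_le_add_one K (N := t' + t' + 1) q
    rw [rank_half_eq_of_level_eq K (show t' + t' + 1 + 1 = t' + 1 + (t' + 1) by omega), hq] at hR
    rw [finrank_recSpace_eq_sub_min K (show t' + 1 ≤ t' + t' + 1 by omega) q, min_eq_right (show t' + t' + 1 + 1 - (t' + 1) ≤ t' + 1 + 1 by omega),
      min_eq_left (show t' + t' + 1 + 1 - (t' + 1) ≤ (hankel1 K (t' + t' + 1) ((t' + t' + 1) / 2) q).rank by omega)]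
    omega

/-- **A BASIS ADAPTED TO `∞`: for `R^{2t}(q) = t + 1` there are `g₁ ∈ Rec_{t+1}(q)` of degree `≤ t`, `g₁ ≠ 0`, and `g₂ ∈ Rec_{t+1}(q)` of degree exactly `t + 1`; they are independent
(so §591 applies to them).** -/
theorem exists_basis_recSpace_top {t : ℕ} {q : ℕ → K} (hq : (hankel1 K (t + t) ((t + t) / 2) q).rank = t + 1) :
    ∃ g₁ g₂ : K[X], g₁ ∈ recSpace K (t + t) q (t + 1) ∧ g₁ ≠ 0 ∧ g₁.natDegree ≤ t ∧ g₂ ∈ recSpace K (t + t) q (t + 1) ∧ g₂.natDegree = t + 1 ∧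
      g₂ ∉ (Polynomial.degreeLT K (0 + 1)).map (LinearMap.mulRight K g₁) := by
  haveI := finiteDimensional_recSpace K (N := t + t) q (t + 1)
  have hdim := finrank_recSpace_top K hq (k := t + 1) (by omega) (by omega)
  have hW := finrank_recSpace_inf_degreeLT_top K hq
  -- a non-zero element of degree `≤ t`
  have hWne : recSpace K (t + t) q (t + 1) ⊓ Polynomial.degreeLT K (t + 1) ≠ ⊥ := by
    intro h; rw [h, finrank_bot] at hW; omega
  obtain ⟨g₁, ⟨hg₁, hg₁deg⟩, hg₁0⟩ := Submodule.exists_mem_ne_zero_of_ne_bot hWne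
  -- an element of full degree: `Rec_{t+1}` is not inside `K[X]_{≤ t}`
  have hlt : ¬ recSpace K (t + t) q (t + 1) ≤ Polynomial.degreeLT K (t + 1) := by
    intro hle
    rw [inf_eq_left.mpr hle] at hW
    omega
  obtain ⟨g₂, hg₂, hg₂deg⟩ := Set.not_subset.mp hlt
  have hg₂le : g₂.natDegree ≤ t + 1 := (mem_degreeLT_succ_iff K).mp (recSpace_le_degreeLT K q _ hg₂)
  have hg₂eq : g₂.natDegree = t + 1 := by
    have : ¬ g₂.natDegree ≤ t := fun h => hg₂deg ((mem_degreeLT_succ_iff K).mpr h)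
    omega
  refine ⟨g₁, g₂, hg₁, hg₁0, (mem_degreeLT_succ_iff K).mp hg₁deg, hg₂, hg₂eq, ?_⟩
  rintro ⟨ρ, hρ, hρg⟩
  rw [LinearMap.mulRight_apply] at hρg
  have hρC : ρ = Polynomial.C (ρ.coeff 0) := Polynomial.eq_C_of_natDegree_le_zero ((mem_degreeLT_succ_iff K).mp hρ)
  have hdeg : g₂.natDegree ≤ t := by
    rw [← hρg, hρC]
    exact (Polynomial.natDegree_C_mul_le _ _).trans ((mem_degreeLT_succ_iff K).mp hg₁deg)
  omega

end Summit.Ventures.HSemireg.Wedge.HankelOuter
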